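import Summits.BirchSwinnertonDyer.Rank1Residual.Partition.MainConjecturesCoveredAllPrimesIdentity
import Literature.NumberTheory.EllipticCurves.Rank1Residual.ClassX1KellerYinCertificate
import Literature.NumberTheory.EllipticCurves.BSDSelmerCMPConverseKLevelProofs
import Literature.NumberTheory.EllipticCurves.BSDSelmerSkinnerProofs
import HarnessLib

/-!
# The citation-of-record facts of rows C2, C16 and C3 — BCS 2025 Cor. 1.3.1, Yan–Zhu 2026 Thm. 4.15
# (as vendored, every `p ≥ 3`), JSW 2017 Thm. 1.2.1 — DERIVED LITERALLY from the main-conjecture-level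
# published facts (C3 modulo the typed signed main conjecture on its supersingular sub-case)
# (cell `b2b-bsdres`, GLUE seat gen 9; a leaf over `MainConjecturesCoveredAllPrimesIdentity.lean`)

HONEST FRAMING (cell `b2b-bsdres`, run/shared/lean/b2b/bsd-rank1-residual/, verbatim in every
file): the goal of the cell is to DELETE the COMBINATION-SHAPED residual classes of the
Birch–Swinnerton-Dyer formula for ALL analytic-rank `≤ 1` elliptic curves over `ℚ` — "full BSD
formula for every rank `≤ 1` curve in class `C`" assembled STRICTLY from published theorems — so
that the rank-`≤ 1` remainder becomes exactly the CONSTRUCTION-SHAPED classes, which are TYPED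
(missing-input `Prop`s), NOT attempted. This is not "finishing BSD". Research routes; no claim
beyond the stated classes; nothing booked; no label changes. THEOREMS ONLY (no definition, no named
fact, no `sorry`); every published theorem enters as one of the tree's existing named Literature
facts BY NAME; every unproved / untyped-in-Literature statement enters as an EXPLICIT binder.

## What this file records

Gen 5 derived the citation-of-record facts of rows C1 (Skinner 2016 Thm. C,
`RowC1.skinnerThmC_of_mainConjectures`) and C10 (Kobayashi 2013 Cor. 1.4) LITERALLY from MC-level
facts, so that the registry could carry them as DERIVED. For the irreducible rank-one rows this was
impossible while the kernel derivation carried the Tamagawa proviso. With the proviso gone (this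
gen's identity form), the three remaining rank-one citation-of-record facts follow LITERALLY — as
the `Prop`s the tree vendored, hypotheses and conclusion verbatim:

* `RowC2.bcsCor131_of_publishedFacts_of_identityLink :
    … → BurungaleCastellaSkinner2025.cor131_padicValRat_bsd_rank_le_one` — BCS IMRN 2025 Cor. 1.3.1
  (`¬cm`, `p > 3` good ordinary, (irr_ℚ), (im), `r_an ≤ 1`, `Ш` finite ⇒ `L^{(r)}(E,1)/(Reg·Ω_E)`
  rational of valuation `ord_p #Ш + ord_p ∏c_ℓ`) FROM: BCS Thm. 1.1.2 (b) (`hBCS`), BCS Thm. 1.2.4 (b) ∘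
  CGLS 5.1.3 (`h124`), JSW Thm. 3.3.1 (`h331`), Greenberg 4.1, Gross–Zagier, Kolyvagin, GZK,
  modularity, Hoffstein–Luo / BFH, Mazur (Manin), Néron scaling; the torsion term vanishes under
  (irr) (`padicValNat_torsionOrder_eq_zero_of_irreducible`, Mazur). = BCS's printed proof (p. 4).
* `yzThm415_of_publishedFacts_of_identityLink : … → YanZhu2026.thm415_padicValRat_bsd_rank_le_one` —
  the tree's transcription of Yan–Zhu Thm. 4.15 = Cor. 1.4 (EVERY `p ≥ 3` good ordinary, (irr), (Im)
  witnessed by `p`-adic surjectivity at every level OR by a ramified multiplicative prime, `r_an ≤ 1`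
  ⇒ `Ш` finite ∧ the product shape with the printed valuation) FROM: at `p = 3` Yan–Zhu Thm. 4.9
  (`hYZ`) + Yan–Zhu Thm. 4.12 ∘ CGLS 5.1.3 (`h412`) + JSW 3.3.1 + Wuthrich L. 20 (row C16); at `p > 3`
  BCS 1.1.2 (b) + BCS 1.2.4 (b) ∘ CGLS 5.1.3 + JSW 3.3.1 (row C2: `¬cm` from the (Im)-witness —
  surjectivity at a good ordinary `p ≥ 5` (`not_hasCM_of_hasSurjectiveModNGaloisRep_of_five_le`,
  Serre §4.5) or a multiplicative prime (`not_hasCM_of_hasMultiplicativeReductionAtPrime'`, integral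
  `j`); (im) from the witness by `X9.bigIm_of_hasSurjectiveModNGaloisRep_pow` / `X9.bigIm_of_irr_of_ram`).
* `RowC3.jswThm121_of_publishedFacts_of_kobayashiMainConjecture_of_identityLink :
    … → (hKMC : ∀ pairs of row C3 with p ∣ a_p, Kobayashi's signed MC for one sign) →
    JetchevSkinnerWan2017.thm121_padicValRat_bsd_rank_one` — JSW Camb. J. Math. 2017 Thm. 1.2.1
  (semistable, `p ≥ 3` good, "`p = 3 ∧ 3 ∣ a_3 ⇒ a_3 = 0`", (irr), `r_an = 1`, `Ш` finite ⇒ product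
  shape) FROM the ordinary-branch facts above (BCS at `p ≥ 5`, Yan–Zhu at `p = 3`; (sur) by Diamond's
  refined Serre `hLL`) and, on the supersingular sub-case ONLY, the cell's TYPED Kobayashi signed main
  conjecture (`hKMC`, OPEN in print off CM / `a_p = 0` — BSTW arXiv:2409.01350v2 Thm. 1.3 announced)
  + BKO 2024 Cor. A.5 (`hA5`). So the flag `JSW-ss` on the fact marks EXACTLY the typed part.

Registry reading (for the cell lead / referee, not decided here): the named facts
`cor131_padicValRat_bsd_rank_le_one` (T-BCS) and `thm415_padicValRat_bsd_rank_le_one` (T-YZ) are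
IMPLIED by the other named facts listed (they may be carried as DERIVED, like A2 / Kobayashi Cor. 1.4
after gen 5); `thm121_padicValRat_bsd_rank_one` (T-JSW) is implied on its ordinary branch. The PUB\*
flags of BCS 2025 (`BCS25-IMC-equiv@BSTW`) travel with `hBCS` / `h124` as before.

References: [BurungaleCastellaSkinner2025] Thm. 1.1.2 (b), 1.2.4 (b), Cor. 1.3.1 (p. 4);
[YanZhu2024MainConjNonCM] Thm. 4.9, 4.12, 4.15 (§4.6) = Cor. 1.4; [JetchevSkinnerWan2017] Thm. 1.2.1,
Thm. 3.3.1; [CastellaGrossiLeeSkinner2022] Thm. 5.1.3; [Mazur1977] III §5; [Serre1972] §4.5;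
[Miller2011LMS] Def. 1.1; HOME/b2b-bsdres-lit-glue/GLUE.md GEN 9 ADDENDUM.
-/

set_option autoImplicit false

noncomputable section

open scoped Classical

open CongruenceSubgroup WeierstrassCurve NumberField IsDedekindDomain
  Literature.NumberTheory.EllipticCurves Literature.NumberTheory.Automorphic
  Literature.NumberTheory.EllipticCurves.ModularForms
  Literature.NumberTheory.EllipticCurves.Rank1Residual
  Literature.NumberTheory.EllipticCurves.CastellaGrossiLeeSkinner2022
  Literature.NumberTheory.EllipticCurves.BurungaleCastellaSkinner2025
  Literature.NumberTheory.EllipticCurves.YanZhu2026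
  Literature.NumberTheory.EllipticCurves.BurungaleKobayashiOta2024
  Literature.NumberTheory.EllipticCurves.JetchevSkinnerWan2017
  Summit.BirchSwinnertonDyer.BirchSwinnertonDyer.Theorems.Rank1ResidualX1Defs

namespace Summit.BirchSwinnertonDyer.Rank1Residual

/-- **BCS 2025 Cor. 1.3.1 — the tree's named fact `cor131_padicValRat_bsd_rank_le_one`, LITERALLY —
DERIVED from the main-conjecture-level published facts** (BCS Thm. 1.1.2 (b) `hBCS`, BCS Thm. 1.2.4
(b) ∘ CGLS Thm. 5.1.3 `h124`, JSW Thm. 3.3.1 `h331`, Greenberg 4.1 `hGr`, Gross–Zagier `hGZ`,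
Kolyvagin `hKo` (rank/finiteness over `K`), GZK `hGZK`, modularity `hmod`/`hpar`/`hnf`,
Hoffstein–Luo / BFH `hHL`, Mazur (Manin) `hMaz`, Néron scaling `hNS`): `BSD(E,p)` by
`RowC2.bsdp_of_publishedFacts_of_identityLink`, back to the print shape by `pPart_of_bsdp`, torsion
term zero under (irr) (`padicValNat_torsionOrder_eq_zero_of_irreducible`). This is the printed proof
of Cor. 1.3.1 (arXiv:2405.00270v2 p. 4), kernel-checked with NO residual binder.
[cite: BurungaleCastellaSkinner2025, Thm. 1.1.2 (b), Thm. 1.2.4 (b), Cor. 1.3.1 and its proof (p. 4)]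
[cite: JetchevSkinnerWan2017, Thm. 3.3.1] [cite: CastellaGrossiLeeSkinner2022, Thm. 5.1.3]
[cite: Mazur1977, Ch. III §5 (p. 157)] [cite: Miller2011LMS, Def. 1.1] -/
theorem RowC2.bcsCor131_of_publishedFacts_of_identityLink
    (hGZ : ∀ (N : ℕ) [NeZero N] (W : WeierstrassCurve ℚ) (K : Type) [Field K] [NumberField K],
      gross_zagier N W K)
    (hKo : ∀ (N : ℕ) [NeZero N] (W : WeierstrassCurve ℚ) (K : Type) [Field K] [NumberField K],
      kolyvagin N W K)
    (hBCS : thm112b_charIdeal_eq_padicLFunction_integral) (h331 : thm331_anticyclotomicControl)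
    (h124 : thm124b_thm513_generator_constantCoeff)
    (hGr : greenberg_charValue_rankZero) (hGZK : rank_eq_analyticRank_of_analyticRank_le_one)
    (hmod : hasEntireLFunction_rat) (hpar : nonempty_modularParametrizationData)
    (hnf : exists_isNewformOf) (hHL : HoffsteinLuo1997_exists_twist_L_one_ne_zero)
    (hMaz : mazur_not_dvd_maninConstant_of_odd) (hNS : integral_neronScaling_of_isGloballyMinimal) :
    BurungaleCastellaSkinner2025.cor131_padicValRat_bsd_rank_le_one := by
  intro W _ _ p _ hncm hp hord hirr him hr _hfin
  have hB : BSDp W p :=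
    RowC2.bsdp_of_publishedFacts_of_identityLink W p hGZ hKo hBCS h331 h124 hGr hGZK hmod hpar hnf hHL
      hMaz hNS ⟨hncm, hp, hord, hirr, him⟩ hr
  obtain ⟨q, hq, hv⟩ := pPart_of_bsdp hmod hGZK W p hr hB
  refine ⟨q, hq, ?_⟩
  rw [hv, padicValNat_torsionOrder_eq_zero_of_irreducible (hirr := hirr)]
  push_cast
  ring

/-- **Yan–Zhu 2026 Thm. 4.15 as vendored (`thm415_padicValRat_bsd_rank_le_one`, EVERY `p ≥ 3`),
LITERALLY — DERIVED from the main-conjecture-level published facts**: at `p = 3` Yan–Zhu Thm. 4.9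
(`hYZ`) + Yan–Zhu Thm. 4.12 ∘ CGLS 5.1.3 (`h412`) + JSW 3.3.1 (`h331`) + Wuthrich L. 20 (`hW20`) via
`RowC16.bsdp_of_publishedFacts_of_identityLink` (surj(3) ⇐ the first (Im)-witness at level `1`, or
the ramified multiplicative prime IS `Ram W 3`); at `p > 3` BCS Thm. 1.1.2 (b) (`hBCS`) + BCS Thm.
1.2.4 (b) ∘ CGLS 5.1.3 (`h124`) + JSW 3.3.1 via `RowC2.bsdp_of_publishedFacts_of_identityLink`
(`¬cm` from the (Im)-witness: surjectivity at a good ordinary `p ≥ 5` —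
`not_hasCM_of_hasSurjectiveModNGaloisRep_of_five_le` — or a multiplicative prime —
`not_hasCM_of_hasMultiplicativeReductionAtPrime'`; (im) by `X9.bigIm_of_hasSurjectiveModNGaloisRep_pow`
/ `X9.bigIm_of_irr_of_ram`); `Ш` finite by GZK; back to the product shape by `pPart_of_bsdp` and
`pPart_iff_productShape`. [cite: YanZhu2024MainConjNonCM, Thm. 4.9, Thm. 4.12, Thm. 4.15 (§4.6) = Cor. 1.4 (§1.1)]
[cite: BurungaleCastellaSkinner2025, Thm. 1.1.2 (b), Thm. 1.2.4 (b), Cor. 1.3.1] [cite: JetchevSkinnerWan2017, Thm. 3.3.1]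
[cite: Wuthrich2014, Lemma 20 (p. 399)] [cite: Serre1972, §4.5] [cite: Miller2011LMS, Def. 1.1] -/
theorem yzThm415_of_publishedFacts_of_identityLink
    (hGZ : ∀ (N : ℕ) [NeZero N] (W : WeierstrassCurve ℚ) (K : Type) [Field K] [NumberField K],
      gross_zagier N W K)
    (hKo : ∀ (N : ℕ) [NeZero N] (W : WeierstrassCurve ℚ) (K : Type) [Field K] [NumberField K],
      kolyvagin N W K)
    (hBCS : thm112b_charIdeal_eq_padicLFunction_integral)
    (hYZ : thm49_charIdeal_eq_padicLFunction_integral)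
    (hW20 : Wuthrich2014.lemma20_surjective_threeAdic_of_semistable)
    (h331 : thm331_anticyclotomicControl) (h124 : thm124b_thm513_generator_constantCoeff)
    (h412 : thm412_thm513_generator_constantCoeff)
    (hGr : greenberg_charValue_rankZero) (hGZK : rank_eq_analyticRank_of_analyticRank_le_one)
    (hmod : hasEntireLFunction_rat) (hpar : nonempty_modularParametrizationData)
    (hnf : exists_isNewformOf) (hHL : HoffsteinLuo1997_exists_twist_L_one_ne_zero)
    (hMaz : mazur_not_dvd_maninConstant_of_odd) (hNS : integral_neronScaling_of_isGloballyMinimal) :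
    YanZhu2026.thm415_padicValRat_bsd_rank_le_one := by
  intro W _ _ p _ hp3 hgood hord hirr hIm hr
  have hpP : p.Prime := Fact.out
  refine ⟨(hGZK W hr).2, ?_⟩
  have hB : BSDp W p := by
    by_cases h3 : p = 3
    · subst h3
      have hsr : Surj W 3 ∨ Ram W 3 := by
        rcases hIm with htower | hram
        · exact Or.inl (show W.HasSurjectiveModNGaloisRep 3 by simpa using htower 1)
        · exact Or.inr hram
      exact RowC16.bsdp_of_publishedFacts_of_identityLink W 3 hGZ hKo hYZ hW20 h331 h412 hGr hGZK hmod
        hpar hnf hHL hMaz hNS ⟨rfl, ⟨hgood, hord⟩, hirr, hsr⟩ hr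
    · have hp5 : 5 ≤ p := hpP.five_le_of_ne_two_of_ne_three (by omega) h3
      have hbig : BigIm W p := by
        rcases hIm with htower | hram
        · exact X9.bigIm_of_hasSurjectiveModNGaloisRep_pow W p htower
        · exact X9.bigIm_of_irr_of_ram W p hirr hram
      have hncm : ¬ W.HasCM := by
        rcases hIm with htower | ⟨ℓ, hℓ, -, hmult, -⟩
        · exact not_hasCM_of_hasSurjectiveModNGaloisRep_of_five_le W p hp5 hgood hord
            (by simpa using htower 1)
        · haveI := hℓ
          exact not_hasCM_of_hasMultiplicativeReductionAtPrime' W hmult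
      exact RowC2.bsdp_of_publishedFacts_of_identityLink W p hGZ hKo hBCS h331 h124 hGr hGZK hmod hpar
        hnf hHL hMaz hNS ⟨hncm, by omega, ⟨hgood, hord⟩, hirr, hbig⟩ hr
  exact (pPart_iff_productShape W p).mp (pPart_of_bsdp hmod hGZK W p hr hB)

/-- **JSW 2017 Thm. 1.2.1 — the tree's named fact `thm121_padicValRat_bsd_rank_one`, LITERALLY —
DERIVED from the main-conjecture-level published facts on its ordinary branch and the cell's TYPED
Kobayashi signed main conjecture on its supersingular sub-case** (`hKMC`: for every row-C3 pair with
`p ∣ a_p`, the signed main conjecture for ONE sign — OPEN in print off CM / `a_p = 0`; + BKO 2024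
Cor. A.5 `hA5`). The row predicate is rebuilt from the fact's printed hypotheses (semistable over
`𝓞 ℚ` ⇒ `Semistable W`; at `p = 3`: `3 ∤ a_3` ⇒ ordinary, else `a_3 = 0` by the printed proviso);
`BSD(E,p)` by `RowC3.bsdp_of_publishedFacts_of_kobayashiMainConjecture_of_identityLink` ((sur) by
Diamond's refined Serre `hLL`; column MC = BCS 1.1.2 (b) `p ≥ 5` / Yan–Zhu 4.9 `p = 3`; two-sided
anticyclotomic link = BCS 1.2.4 (b) / Yan–Zhu 4.12 ∘ CGLS 5.1.3; control = JSW 3.3.1); back to the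
product shape by `pPart_of_bsdp` + `pPart_iff_productShape`. So the fact's flag `JSW-ss` marks
EXACTLY the typed input. [cite: JetchevSkinnerWan2017, Thm. 1.2.1 (§1.2), Thm. 3.3.1, §7.4]
[cite: BurungaleCastellaSkinner2025, Thm. 1.1.2 (b), Thm. 1.2.4 (b)] [cite: YanZhu2024MainConjNonCM, Thm. 4.9, Thm. 4.12]
[cite: BurungaleKobayashiOta2023, App. A Cor. A.5] [cite: Miller2011LMS, Def. 1.1] -/
theorem RowC3.jswThm121_of_publishedFacts_of_kobayashiMainConjecture_of_identityLink
    (hGZ : ∀ (N : ℕ) [NeZero N] (W : WeierstrassCurve ℚ) (K : Type) [Field K] [NumberField K],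
      gross_zagier N W K)
    (hKo : ∀ (N : ℕ) [NeZero N] (W : WeierstrassCurve ℚ) (K : Type) [Field K] [NumberField K],
      kolyvagin N W K)
    (hBCS : thm112b_charIdeal_eq_padicLFunction_integral)
    (hYZ : thm49_charIdeal_eq_padicLFunction_integral)
    (hW20 : Wuthrich2014.lemma20_surjective_threeAdic_of_semistable)
    (h331 : thm331_anticyclotomicControl) (h124 : thm124b_thm513_generator_constantCoeff)
    (h412 : thm412_thm513_generator_constantCoeff)
    (hA5 : corA5_pPart_of_signedCharIdeal_eq)
    (hGr : greenberg_charValue_rankZero) (hGZK : rank_eq_analyticRank_of_analyticRank_le_one)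
    (hmod : hasEntireLFunction_rat) (hpar : nonempty_modularParametrizationData)
    (hnf : exists_isNewformOf) (hLL : diamond1995_refinedSerre)
    (hHL : HoffsteinLuo1997_exists_twist_L_one_ne_zero)
    (hMaz : mazur_not_dvd_maninConstant_of_odd) (hNS : integral_neronScaling_of_isGloballyMinimal)
    -- the cell's TYPED input on the supersingular sub-case of the row: Kobayashi's signed MC, one sign
    (hKMC : ∀ (W : WeierstrassCurve ℚ) [W.IsElliptic] [W.IsGloballyMinimal] (p : ℕ) [Fact p.Prime],
      RowC3 W p → (p : ℤ) ∣ W.frobeniusTrace p → ∃ ε : ℤˣ, Supersingular.KobayashiMainConjecture W p ε) :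
    JetchevSkinnerWan2017.thm121_padicValRat_bsd_rank_one := by
  intro W _ _ p _ hp3 hsstO hgood h3 hirr hr1 _hfin
  have hpP : p.Prime := Fact.out
  have hsst : Semistable W := (semistable_iff_isSemistable_ringOfIntegers W).mpr hsstO
  -- the row's prime clause from the printed hypotheses
  have hp : 5 ≤ p ∨ (p = 3 ∧ (GoodOrd W p ∨ W.frobeniusTrace 3 = 0)) := by
    by_cases h5 : 5 ≤ p
    · exact Or.inl h5
    · have hp3' : p = 3 := by
        by_contra hne
        exact h5 (hpP.five_le_of_ne_two_of_ne_three (by omega) hne)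
      refine Or.inr ⟨hp3', ?_⟩
      subst hp3'
      by_cases hdvd : (3 : ℤ) ∣ W.frobeniusTrace 3
      · exact Or.inr (h3 rfl hdvd)
      · exact Or.inl ⟨hgood, by exact_mod_cast hdvd⟩
  have hC3 : RowC3 W p := ⟨hr1, hsst, hgood, hirr, hp⟩
  -- `BSD(E,p)` from the identity-form row theorem, the signed MC fed on the supersingular sub-case
  have hB : BSDp W p := by
    by_cases hdvd : (p : ℤ) ∣ W.frobeniusTrace p
    · obtain ⟨ε, hε⟩ := hKMC W p hC3 hdvd
      exact RowC3.bsdp_of_publishedFacts_of_kobayashiMainConjecture_of_identityLink W p hGZ hKo hBCS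
        hYZ hW20 h331 h124 h412 hA5 hGr hGZK hmod hpar hnf hLL hHL hMaz hNS hC3 ε (fun _ ↦ hε)
    · exact RowC3.bsdp_of_publishedFacts_of_kobayashiMainConjecture_of_identityLink W p hGZ hKo hBCS
        hYZ hW20 h331 h124 h412 hA5 hGr hGZK hmod hpar hnf hLL hHL hMaz hNS hC3 1
        (fun h ↦ absurd h hdvd)
  exact (pPart_iff_productShape W p).mp (pPart_of_bsdp hmod hGZK W p hr1.le hB)

end Summit.BirchSwinnertonDyer.Rank1Residual

end
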